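import Literature.Topology.FourManifolds.RadialDiffeomorph
import Literature.Topology.FourManifolds.CapBlend
import Mathlib.Analysis.SpecialFunctions.SmoothTransition
import HarnessLib

/-!
# Star-shaped solids with a smooth radial function are diffeomorphic images of the ball

Topic `Literature/Topology/FourManifolds`.  A classical device (Hirsch, *Differential Topology*
(1976), Ch. 8 §3; used here for the explicit models in the proof of the smooth Schönflies theorem,
Schultens (2014), Thm. 3.2.5): let `p₀ ∈ E` and let `c : E → ℝ` be a **direction profile** —
positive, bounded below by `m₀ > 0`, constant along open rays from `0`, smooth away from `0`.
The **radial map** `Φ(y) = p₀ + μ(y) y`, `μ(y) = χ₀(‖y‖) c(y) + (1 - χ₀(‖y‖)) m₀` (`χ₀` a cutoff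
vanishing near `0`), is a diffeomorphism of `E` carrying the closed unit ball onto the
star-shaped solid `{x : ‖x - p₀‖ ≤ c(x - p₀)}`, the unit sphere onto its boundary
`{‖x - p₀‖ = c(x - p₀)}` and the open ball onto `{‖x - p₀‖ < c(x - p₀)}`, preserving directions
from `p₀` (`exists_diffeomorph`, `image_closedBall`, `image_sphere`, `image_ball`).

(This is the generic form of the "can map" of the earlier explicit models; the radial function
of each ray `t ↦ t μ(t u)` is strictly increasing and onto `[0, ∞)`.)

## References
* M. W. Hirsch, *Differential Topology*, GTM 33 (1976), Ch. 8 §3.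
* J. Schultens, *Introduction to 3-Manifolds*, GSM 151 (2014), Thm. 3.2.5.
-/

noncomputable section

open Set Metric Filter Topology Function
open scoped ContDiff Manifold

namespace Literature.Topology.FourManifolds.RadialBallMap

variable {E : Type*} [NormedAddCommGroup E] [InnerProductSpace ℝ E]

/-- **Direction profile**: `c ≥ m₀ > 0`, constant along open rays, smooth off `0`. [folklore] -/
structure IsProfile (c : E → ℝ) (m₀ : ℝ) : Prop where
  pos : 0 < m₀
  lower : ∀ y, m₀ ≤ c y
  ray : ∀ (y : E) (t : ℝ), 0 < t → c (t • y) = c y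
  smooth : ∀ y, y ≠ 0 → ContDiffAt ℝ ∞ c y

/-! ### §1 The radial cutoff and the factor -/

/-- The radial cutoff `χ₀(t) = S(4t - 1)`: `0` for `t ≤ 1/4`, `1` for `t ≥ 1/2`. [folklore] -/
def radCut (t : ℝ) : ℝ := Real.smoothTransition (4 * t - 1)

/-- `χ₀ = 0` below `1/4`. [folklore] -/
theorem radCut_of_le {t : ℝ} (h : t ≤ 1 / 4) : radCut t = 0 :=
  Real.smoothTransition.zero_of_nonpos (by linarith)

/-- `χ₀ = 1` above `1/2`. [folklore] -/
theorem radCut_of_ge {t : ℝ} (h : 1 / 2 ≤ t) : radCut t = 1 :=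
  Real.smoothTransition.one_of_one_le (by linarith)

/-- `χ₀ ∈ [0, 1]`. [folklore] -/
theorem radCut_mem (t : ℝ) : 0 ≤ radCut t ∧ radCut t ≤ 1 :=
  ⟨Real.smoothTransition.nonneg _, Real.smoothTransition.le_one _⟩

/-- `χ₀` is monotone. [folklore] -/
theorem radCut_mono : Monotone radCut := fun a b hab =>
  Real.smoothTransition.monotone (by linarith)

/-- `χ₀` is smooth. [folklore] -/
theorem contDiff_radCut : ContDiff ℝ ∞ radCut :=
  Real.smoothTransition.contDiff.comp ((contDiff_const.mul contDiff_id).sub contDiff_const)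

variable {c : E → ℝ} {m₀ : ℝ} {p₀ : E}

/-- **The radial factor** `μ(y) = χ₀(‖y‖) c(y) + (1 - χ₀(‖y‖)) m₀`. [folklore] -/
def factor (c : E → ℝ) (m₀ : ℝ) (y : E) : ℝ := radCut ‖y‖ * c y + (1 - radCut ‖y‖) * m₀

/-- **The radial map** `Φ(y) = p₀ + μ(y) y`. [folklore] -/
def rmap (p₀ : E) (c : E → ℝ) (m₀ : ℝ) (y : E) : E := p₀ + factor c m₀ y • y

/-- `m₀ ≤ μ`. [folklore] -/
theorem le_factor (h : IsProfile c m₀) (y : E) : m₀ ≤ factor c m₀ y := by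
  have h1 := h.lower y
  obtain ⟨r0, r1⟩ := radCut_mem ‖y‖
  unfold factor; nlinarith

/-- `μ > 0`. [folklore] -/
theorem factor_pos (h : IsProfile c m₀) (y : E) : 0 < factor c m₀ y :=
  lt_of_lt_of_le h.pos (le_factor h y)

/-- `μ ≤ c`. [folklore] -/
theorem factor_le (h : IsProfile c m₀) (y : E) : factor c m₀ y ≤ c y := by
  have h1 := h.lower y
  obtain ⟨r0, r1⟩ := radCut_mem ‖y‖
  unfold factor; nlinarith

/-- `μ` is smooth. [folklore] -/
theorem contDiff_factor (h : IsProfile c m₀) : ContDiff ℝ ∞ (factor c m₀) := by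
  rw [contDiff_iff_contDiffAt]
  intro y
  by_cases hy : ‖y‖ < 1 / 4
  · have hev : factor c m₀ =ᶠ[𝓝 y] fun _ => m₀ := by
      filter_upwards [(isOpen_lt continuous_norm continuous_const).mem_nhds hy] with z hz
      unfold factor
      rw [radCut_of_le (le_of_lt hz)]; ring
    exact (contDiffAt_const (c := m₀)).congr_of_eventuallyEq hev
  · push Not at hy
    have hy0 : y ≠ 0 := by intro h0; rw [h0, norm_zero] at hy; norm_num at hy
    have hn : ContDiffAt ℝ ∞ (fun z : E => ‖z‖) y := contDiffAt_norm ℝ hy0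
    unfold factor
    exact ((contDiff_radCut.contDiffAt.comp y hn).mul (h.smooth y hy0)).add
      ((contDiffAt_const.sub (contDiff_radCut.contDiffAt.comp y hn)).mul contDiffAt_const)

/-- `Φ` is smooth. [folklore] -/
theorem contDiff_rmap (h : IsProfile c m₀) : ContDiff ℝ ∞ (rmap p₀ c m₀) := by
  unfold rmap
  exact contDiff_const.add ((contDiff_factor h).smul contDiff_id)

/-- `Φ(0) = p₀`. [folklore] -/
theorem rmap_zero : rmap p₀ c m₀ 0 = p₀ := by simp [rmap]

/-- `Φ(y) - p₀ = μ(y) y`. [folklore] -/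
theorem rmap_sub (y : E) : rmap p₀ c m₀ y - p₀ = factor c m₀ y • y := by simp [rmap]

/-- `‖Φ(y) - p₀‖ = μ(y) ‖y‖`. [folklore] -/
theorem norm_rmap_sub (h : IsProfile c m₀) (y : E) : ‖rmap p₀ c m₀ y - p₀‖ = factor c m₀ y * ‖y‖ := by
  rw [rmap_sub, norm_smul, Real.norm_eq_abs, abs_of_pos (factor_pos h y)]

/-- Along a unit ray: `μ(t u₀) = m₀ + χ₀(t) (c(u₀) - m₀)` (`t > 0`). [folklore] -/
theorem factor_smul (h : IsProfile c m₀) {u₀ : E} (hu₀ : ‖u₀‖ = 1) {t : ℝ} (ht : 0 < t) :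
    factor c m₀ (t • u₀) = m₀ + radCut t * (c u₀ - m₀) := by
  unfold factor
  rw [norm_smul, Real.norm_eq_abs, abs_of_pos ht, hu₀, mul_one, h.ray u₀ t ht]
  ring

/-- **The radial function of a ray is strictly increasing** on `(0, ∞)`. [folklore] -/
theorem radial_strictMonoOn (h : IsProfile c m₀) {u₀ : E} (hu₀ : ‖u₀‖ = 1) :
    StrictMonoOn (fun t : ℝ => t * factor c m₀ (t • u₀)) (Ioi 0) := by
  intro a ha b hb hab
  simp only [mem_Ioi] at ha hb
  simp only [factor_smul h hu₀ ha, factor_smul h hu₀ hb]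
  have hc : m₀ ≤ c u₀ := h.lower u₀
  have hmono := radCut_mono hab.le
  obtain ⟨r0, r1⟩ := radCut_mem a
  have hpos := h.pos
  have hfa : m₀ ≤ m₀ + radCut a * (c u₀ - m₀) := by nlinarith
  have hle : m₀ + radCut a * (c u₀ - m₀) ≤ m₀ + radCut b * (c u₀ - m₀) := by nlinarith
  calc a * (m₀ + radCut a * (c u₀ - m₀)) < b * (m₀ + radCut a * (c u₀ - m₀)) :=
        mul_lt_mul_of_pos_right hab (by linarith)
    _ ≤ b * (m₀ + radCut b * (c u₀ - m₀)) := mul_le_mul_of_nonneg_left hle hb.le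

/-- **The radial function of a ray is onto `[0, ∞)`.** [folklore] -/
theorem exists_radial_eq (h : IsProfile c m₀) (u₀ : E) {r : ℝ} (hr : 0 ≤ r) :
    ∃ t : ℝ, 0 ≤ t ∧ t * factor c m₀ (t • u₀) = r := by
  set g : ℝ → ℝ := fun t => t * factor c m₀ (t • u₀) with hg
  have hgc : Continuous g := continuous_id.mul ((contDiff_factor h).continuous.comp
    (continuous_id.smul continuous_const))
  have hg0 : g 0 = 0 := by simp [hg]
  set T : ℝ := r / m₀ with hT
  have hT0 : 0 ≤ T := div_nonneg hr h.pos.le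
  have hgT : r ≤ g T := by
    have := le_factor h (T • u₀)
    have h1 : m₀ * T = r := by rw [hT]; field_simp [h.pos.ne']
    simp only [hg]; nlinarith
  obtain ⟨t, ht, hgt⟩ := intermediate_value_Icc hT0 hgc.continuousOn ⟨by rw [hg0]; exact hr, hgT⟩
  exact ⟨t, ht.1, hgt⟩

/-- **`Φ` is injective.** [folklore] -/
theorem rmap_injective (h : IsProfile c m₀) : Injective (rmap p₀ c m₀) := by
  intro y₁ y₂ hy
  have h' : factor c m₀ y₁ • y₁ = factor c m₀ y₂ • y₂ := by rw [← rmap_sub y₁, ← rmap_sub y₂, hy]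
  have hf₁ := factor_pos h y₁
  have hf₂ := factor_pos h y₂
  by_cases hy₁ : y₁ = 0
  · subst hy₁
    simp only [smul_zero] at h'
    exact ((smul_eq_zero.1 h'.symm).resolve_left hf₂.ne').symm
  · have hn : factor c m₀ y₁ * ‖y₁‖ = factor c m₀ y₂ * ‖y₂‖ := by
      have := congrArg (fun z => ‖z‖) h'
      simpa only [norm_smul, Real.norm_eq_abs, abs_of_pos hf₁, abs_of_pos hf₂] using this
    set u := ‖y₁‖⁻¹ • y₁ with hu
    have hun : ‖u‖ = 1 := norm_smul_inv_norm (𝕜 := ℝ) hy₁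
    have hu1 : y₁ = ‖y₁‖ • u := by
      rw [hu, smul_smul, mul_inv_cancel₀ (norm_ne_zero_iff.2 hy₁), one_smul]
    have e : y₂ = (factor c m₀ y₁ / factor c m₀ y₂) • y₁ := by
      rw [div_eq_inv_mul, ← smul_smul, h', smul_smul, inv_mul_cancel₀ hf₂.ne', one_smul]
    have e2 : factor c m₀ y₁ / factor c m₀ y₂ * ‖y₁‖ = ‖y₂‖ := by
      field_simp; linarith
    have hu2 : y₂ = ‖y₂‖ • u := by
      calc y₂ = (factor c m₀ y₁ / factor c m₀ y₂) • y₁ := e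
        _ = (factor c m₀ y₁ / factor c m₀ y₂) • (‖y₁‖ • u) := by conv_lhs => arg 2; rw [hu1]
        _ = ‖y₂‖ • u := by rw [smul_smul, e2]
    have hy₂ : 0 < ‖y₂‖ := by
      rw [← e2]; exact mul_pos (div_pos hf₁ hf₂) (norm_pos_iff.2 hy₁)
    have c1 : factor c m₀ y₁ = factor c m₀ (‖y₁‖ • u) := by conv_lhs => rw [hu1]
    have c2 : factor c m₀ y₂ = factor c m₀ (‖y₂‖ • u) := by conv_lhs => rw [hu2]
    have hrad : ‖y₁‖ * factor c m₀ (‖y₁‖ • u) = ‖y₂‖ * factor c m₀ (‖y₂‖ • u) := by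
      rw [← c1, ← c2]; linarith [hn]
    have hinj := (radial_strictMonoOn h hun).injOn
    have heq := hinj (show ‖y₁‖ ∈ Ioi (0:ℝ) from norm_pos_iff.2 hy₁)
      (show ‖y₂‖ ∈ Ioi (0:ℝ) from hy₂) hrad
    rw [hu1, hu2, heq]

/-- **`Φ` is surjective.** [folklore] -/
theorem rmap_surjective (h : IsProfile c m₀) : Surjective (rmap p₀ c m₀) := by
  intro x
  set v := x - p₀ with hv
  by_cases hv0 : v = 0
  · refine ⟨0, ?_⟩
    rw [rmap_zero]; rw [hv, sub_eq_zero] at hv0; exact hv0.symm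
  · set u₀ := ‖v‖⁻¹ • v with hu₀
    obtain ⟨t, -, hgt⟩ := exists_radial_eq h u₀ (norm_nonneg v)
    refine ⟨t • u₀, ?_⟩
    show p₀ + factor c m₀ (t • u₀) • (t • u₀) = x
    rw [smul_smul, mul_comm (factor c m₀ (t • u₀)) t, hgt, hu₀, smul_smul,
      mul_inv_cancel₀ (norm_ne_zero_iff.2 hv0), one_smul, hv]
    abel

/-! ### §2 The radial map is a diffeomorphism -/

/-- The radial derivative of the factor is nonnegative: `Dμ(y)[y] ≥ 0`. [folklore] -/
theorem fderiv_factor_apply_self_nonneg (h : IsProfile c m₀) {y : E} (hy : y ≠ 0) :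
    0 ≤ fderiv ℝ (factor c m₀) y y := by
  set u := ‖y‖⁻¹ • y with hu
  have hun : ‖u‖ = 1 := norm_smul_inv_norm (𝕜 := ℝ) hy
  have hyu : y = ‖y‖ • u := by rw [hu, smul_smul, mul_inv_cancel₀ (norm_ne_zero_iff.2 hy), one_smul]
  have hny : 0 < ‖y‖ := norm_pos_iff.2 hy
  have hc : m₀ ≤ c u := h.lower u
  set ψ : ℝ → ℝ := fun t => m₀ + radCut (t * ‖y‖) * (c u - m₀) with hψ
  have hψm : Monotone ψ := fun a b hab => by
    simp only [hψ]
    have := radCut_mono (mul_le_mul_of_nonneg_right hab hny.le)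
    nlinarith
  have hagree : (fun t : ℝ => factor c m₀ (t • y)) =ᶠ[𝓝 1] ψ := by
    filter_upwards [Ioi_mem_nhds (show (0:ℝ) < 1 by norm_num)] with t ht
    have : t • y = (t * ‖y‖) • u := by
      conv_lhs => rw [hyu]
      rw [smul_smul]
    rw [this, factor_smul h hun (mul_pos ht hny)]
  have hf : HasFDerivAt (factor c m₀) (fderiv ℝ (factor c m₀) y) y :=
    ((contDiff_factor h).differentiable (by simp) y).hasFDerivAt
  have hγ : HasDerivAt (fun t : ℝ => t • y) y 1 := by
    simpa using (hasDerivAt_id (1:ℝ)).smul_const y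
  have hcomp : HasDerivAt (fun t : ℝ => factor c m₀ (t • y)) (fderiv ℝ (factor c m₀) y y) 1 := by
    have hf' : HasFDerivAt (factor c m₀) (fderiv ℝ (factor c m₀) y) ((1:ℝ) • y) := by
      rw [one_smul]; exact hf
    exact hf'.comp_hasDerivAt 1 hγ
  have hψd : HasDerivAt ψ (fderiv ℝ (factor c m₀) y y) 1 := hcomp.congr_of_eventuallyEq hagree.symm
  exact hψd.nonneg_of_monotone hψm

/-- **The differential of `Φ` is injective everywhere.** [folklore] -/
theorem injective_fderiv_rmap (h : IsProfile c m₀) (y : E) : Injective (fderiv ℝ (rmap p₀ c m₀) y) := by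
  have hfpos := factor_pos h y
  have hf : HasFDerivAt (factor c m₀) (fderiv ℝ (factor c m₀) y) y :=
    ((contDiff_factor h).differentiable (by simp) y).hasFDerivAt
  have hD : HasFDerivAt (rmap p₀ c m₀)
      (factor c m₀ y • ContinuousLinearMap.id ℝ _ + (fderiv ℝ (factor c m₀) y).smulRight y) y := by
    have := (hf.smul (hasFDerivAt_id y)).const_add p₀
    exact this
  rw [hD.fderiv]
  intro v w hvw
  rw [← sub_eq_zero] at hvw ⊢
  set d := v - w with hd
  have h0 : factor c m₀ y • d + (fderiv ℝ (factor c m₀) y d) • y = 0 := by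
    set T : E →L[ℝ] E := factor c m₀ y • ContinuousLinearMap.id ℝ E +
      (fderiv ℝ (factor c m₀) y).smulRight y with hT
    have : T d = 0 := by rw [map_sub]; exact hvw
    simpa [hT] using this
  by_cases hy : y = 0
  · have : factor c m₀ y • d = 0 := by rw [hy, smul_zero, add_zero] at h0; rw [hy]; exact h0
    exact (smul_eq_zero.1 this).resolve_left hfpos.ne'
  · set lam : ℝ := -(fderiv ℝ (factor c m₀) y d) / factor c m₀ y with hlam
    have hdl : d = lam • y := by
      have e1 : factor c m₀ y • d = (-(fderiv ℝ (factor c m₀) y d)) • y := by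
        rw [neg_smul, eq_neg_iff_add_eq_zero]; exact h0
      have e2 := congrArg (fun z => (factor c m₀ y)⁻¹ • z) e1
      simp only [smul_smul, inv_mul_cancel₀ hfpos.ne', one_smul] at e2
      rw [e2]; congr 1; rw [hlam]; ring
    have hrad := fderiv_factor_apply_self_nonneg h hy
    rw [hdl, map_smul, smul_eq_mul] at h0
    have : (lam * (factor c m₀ y + fderiv ℝ (factor c m₀) y y)) • y = 0 := by
      rw [← h0, smul_smul, ← add_smul]; ring_nf
    rw [smul_eq_zero] at this
    rcases this with h1 | h1
    · rcases mul_eq_zero.1 h1 with h2 | h2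
      · rw [hdl, h2, zero_smul]
      · linarith
    · exact absurd h1 hy

/-- **The radial map as a diffeomorphism of `E`.** [folklore] -/
theorem exists_diffeomorph [FiniteDimensional ℝ E] (h : IsProfile c m₀) (p₀ : E) :
    ∃ Φ : E ≃ₘ⟮𝓘(ℝ, E), 𝓘(ℝ, E)⟯ E, ∀ y, Φ y = rmap p₀ c m₀ y := by
  have hbij : Bijective (rmap p₀ c m₀) := ⟨rmap_injective h, rmap_surjective h⟩
  set e := Equiv.ofBijective _ hbij with he
  have hsm : ContDiff ℝ ∞ (rmap p₀ c m₀) := contDiff_rmap h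
  have hinv : ContDiff ℝ ∞ e.symm := by
    rw [contDiff_iff_contDiffAt]
    intro x
    obtain ⟨y, rfl⟩ := hbij.2 x
    obtain ⟨L, hL⟩ := CapBlend.exists_continuousLinearEquiv_of_injective (injective_fderiv_rmap h y)
    have hf' : HasFDerivAt (rmap p₀ c m₀) (L : E →L[ℝ] E) y := by
      rw [hL]; exact (hsm.differentiable (by simp) y).hasFDerivAt
    exact contDiffAt_leftInverse hsm.contDiffAt hf' (by simp) e.left_inv
  exact ⟨{ toEquiv := e
           contMDiff_toFun := hsm.contMDiff
           contMDiff_invFun := hinv.contMDiff }, fun y => rfl⟩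

/-! ### §3 Images of the ball and the sphere -/

/-- `c(Φ y - p₀) = c(y)` for `y ≠ 0` (rays to rays). [folklore] -/
theorem profile_rmap_sub (h : IsProfile c m₀) (y : E) : c (rmap p₀ c m₀ y - p₀) = c y := by
  rw [rmap_sub]; exact h.ray y _ (factor_pos h y)

omit [InnerProductSpace ℝ E] in
/-- On and outside the half ball, `μ = c`. [folklore] -/
theorem factor_eq_of_half_le [NormedSpace ℝ E] {y : E} (hy : 1 / 2 ≤ ‖y‖) : factor c m₀ y = c y := by
  unfold factor; rw [radCut_of_ge hy]; ring

/-- **The radial comparison**: for `y ≠ 0`, `‖Φ y - p₀‖ < c(Φ y - p₀)`, `=`, according as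
`‖y‖ < 1`, `= 1`. [folklore] -/
theorem norm_cmp (h : IsProfile c m₀) {y : E} (hy : y ≠ 0) :
    (‖rmap p₀ c m₀ y - p₀‖ < c (rmap p₀ c m₀ y - p₀) ↔ ‖y‖ < 1) ∧
    (‖rmap p₀ c m₀ y - p₀‖ = c (rmap p₀ c m₀ y - p₀) ↔ ‖y‖ = 1) := by
  set u := ‖y‖⁻¹ • y with hu
  have hun : ‖u‖ = 1 := norm_smul_inv_norm (𝕜 := ℝ) hy
  have hyu : y = ‖y‖ • u := by rw [hu, smul_smul, mul_inv_cancel₀ (norm_ne_zero_iff.2 hy), one_smul]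
  have hny : 0 < ‖y‖ := norm_pos_iff.2 hy
  set g : ℝ → ℝ := fun t => t * factor c m₀ (t • u) with hg
  have hmono := radial_strictMonoOn h hun
  have hR : ‖rmap p₀ c m₀ y - p₀‖ = g ‖y‖ := by
    rw [norm_rmap_sub h, mul_comm]
    simp only [hg]
    conv_lhs => rw [hyu]
    rw [norm_smul, Real.norm_eq_abs, abs_of_pos hny, hun, mul_one]
  have hM : c (rmap p₀ c m₀ y - p₀) = g 1 := by
    rw [profile_rmap_sub h]
    simp only [hg, one_mul, one_smul]
    rw [factor_eq_of_half_le (by rw [hun]; norm_num)]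
    conv_lhs => rw [hyu]
    exact h.ray u _ hny
  rw [hR, hM]
  have h1 : (1:ℝ) ∈ Ioi (0:ℝ) := by norm_num
  exact ⟨hmono.lt_iff_lt hny h1, ⟨fun hh => hmono.injOn hny h1 hh, fun hh => by rw [hh]⟩⟩

/-- **`Φ` carries the closed unit ball onto the star-shaped solid** `{‖x - p₀‖ ≤ c(x - p₀)}`.
[folklore] -/
theorem image_closedBall (h : IsProfile c m₀) :
    rmap p₀ c m₀ '' closedBall 0 1 = {x | ‖x - p₀‖ ≤ c (x - p₀)} := by
  ext x
  obtain ⟨y, rfl⟩ := rmap_surjective h (p₀ := p₀) x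
  rw [(rmap_injective h).mem_set_image]
  simp only [mem_closedBall, dist_zero_right, mem_setOf_eq]
  by_cases hy : y = 0
  · subst hy
    simp only [norm_zero, zero_le_one, true_iff, rmap_zero, sub_self, norm_zero]
    exact le_trans h.pos.le (h.lower 0)
  · obtain ⟨h1, h2⟩ := norm_cmp h (p₀ := p₀) hy
    constructor
    · intro hh
      rcases hh.lt_or_eq with hl | he
      · exact (h1.2 hl).le
      · exact (h2.2 he).le
    · intro hh
      rcases hh.lt_or_eq with hl | he
      · exact (h1.1 hl).le
      · exact (h2.1 he).le

/-- **`Φ` carries the unit sphere onto the boundary** `{‖x - p₀‖ = c(x - p₀)}`. [folklore] -/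
theorem image_sphere (h : IsProfile c m₀) :
    rmap p₀ c m₀ '' sphere 0 1 = {x | ‖x - p₀‖ = c (x - p₀)} := by
  ext x
  obtain ⟨y, rfl⟩ := rmap_surjective h (p₀ := p₀) x
  rw [(rmap_injective h).mem_set_image]
  simp only [mem_sphere, dist_zero_right, mem_setOf_eq]
  by_cases hy : y = 0
  · subst hy
    simp only [norm_zero, zero_ne_one, false_iff, rmap_zero, sub_self, norm_zero]
    exact ne_of_lt (lt_of_lt_of_le h.pos (h.lower 0))
  · exact (norm_cmp h (p₀ := p₀) hy).2.symm

/-- **`Φ` carries the open unit ball onto** `{‖x - p₀‖ < c(x - p₀)}`. [folklore] -/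
theorem image_ball (h : IsProfile c m₀) :
    rmap p₀ c m₀ '' ball 0 1 = {x | ‖x - p₀‖ < c (x - p₀)} := by
  ext x
  obtain ⟨y, rfl⟩ := rmap_surjective h (p₀ := p₀) x
  rw [(rmap_injective h).mem_set_image]
  simp only [mem_ball, dist_zero_right, mem_setOf_eq]
  by_cases hy : y = 0
  · subst hy
    simp only [norm_zero, zero_lt_one, true_iff, rmap_zero, sub_self, norm_zero]
    exact lt_of_lt_of_le h.pos (h.lower 0)
  · exact (norm_cmp h (p₀ := p₀) hy).1.symm

end Literature.Topology.FourManifolds.RadialBallMap
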